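import Mathlib
import HarnessLib
import Summits.CriticalPhenomena.SAWScalingLimit.Theses.SAWRenewalTightness
import Literature.Probability.RandomPlanarGeometry.CurveTortuosity
import Literature.Analysis.Complex.BoundaryUniqueness

/-!
# Sketch (ideator 2, crux ShellCrossingBound = stmt-CriticalPhenomena-4728, round 1)

First lemmas of the two idea cards `pinch-on-a-circle` and `socket-comparison`.

* `travMass` — the law-mass of "`k` separate traversals of `D(y; η, R)`" under the critical SAW
  law of the crux (verbatim the set of the crux with general `k, y, η, R`).
* `PerShellTight` — shell-by-shell tightness of the traversal count (no uniformity over shells).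
* `shellCrossingBound_of_perShellTight` — PROVED: per-shell tightness implies the crux
  (choose the shell-dependent threshold with tail `≤ (ρ/R)^3`; `K = 1`, `λ = 3`).
* `exists_pinch_of_hasTraversals` — PROVED: the deterministic pigeonhole on the middle circle:
  `k ≥ 2` traversals of `D(x; ρ₁, R₁)` give `4` traversals of `D(y; 4πr/k, (R₁-ρ₁)/2)` for some
  `y` on the middle sphere `|y - x| = r = (ρ₁+R₁)/2` (IVT for the passage times, boxes of the
  argument for the pigeonhole, chord ≤ arc, continuity just before the passage for strictness).
* `UniformTwoStrandPinch` (UTSP) — the open atom: the crux's inequality with `k = 4`, any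
  exponent `> 1`, outer radii `≤ R₀(D,d)`, centres at distance `≥ d` from the marked points.
* `perShellTight_of_uniformTwoStrandPinch` — the 1-D union bound (provable now; `sorry`).
* `ConfinementPositivity`, `utsp_transfer` — card 2 (restriction comparison; `sorry`).
-/

namespace Summit.CriticalPhenomena.SAWScalingLimit.Cruxes.ShellCrossingBound.Ideator2

open MeasureTheory Set Metric
open Literature.Probability.RandomPlanarGeometry Literature.Probability.LatticeModels
open Summit.CriticalPhenomena.SAWScalingLimit.Theses.SAWRenewalTightness (ShellCrossingBound)

/-! ### The pigeonhole-on-a-circle lemma (PROVED) -/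

section Pinch

open Complex Real
open scoped unitInterval

/-- Intermediate value on a traversal: the segment passes through the middle sphere at a time
strictly after its start. -/
theorem exists_mem_sphere_of_isTraversal {γ : Curve ℂ} {x : ℂ} {ρ₁ R₁ r : ℝ} {s t : I}
    (hρr : ρ₁ < r) (hrR : r < R₁) (h : γ.IsTraversal x ρ₁ R₁ s t) :
    ∃ m : I, s < m ∧ m ≤ t ∧ dist (γ m) x = r := by
  classical
  -- pull back to a continuous real function on `[s, t]`
  set g : ℝ → ℝ := fun u => dist (γ (Set.projIcc (0 : ℝ) 1 zero_le_one u)) x with hg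
  have hgc : Continuous g := (γ.continuous.comp continuous_projIcc).dist continuous_const
  have hgs : g s = dist (γ s) x := by simp [hg, Set.projIcc_val]
  have hgt : g t = dist (γ t) x := by simp [hg, Set.projIcc_val]
  have hst : (s : ℝ) ≤ t := h.1
  -- `r` lies between the endpoint values, in one order or the other
  have hmem : r ∈ g '' Set.Icc (s : ℝ) t := by
    rcases h.2 with ⟨hs, ht⟩ | ⟨hs, ht⟩
    · exact intermediate_value_Icc hst hgc.continuousOn ⟨by rw [hgs]; linarith, by rw [hgt]; linarith⟩
    · exact intermediate_value_Icc' hst hgc.continuousOn ⟨by rw [hgt]; linarith, by rw [hgs]; linarith⟩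
  obtain ⟨c, ⟨hsc, hct⟩, hgc'⟩ := hmem
  have hc01 : c ∈ Set.Icc (0 : ℝ) 1 := ⟨s.2.1.trans hsc, hct.trans t.2.2⟩
  refine ⟨⟨c, hc01⟩, ?_, ?_, ?_⟩
  · -- strict: at time `s` the distance is `≠ r`
    rcases eq_or_lt_of_le (show s ≤ (⟨c, hc01⟩ : I) from hsc) with heq | hlt
    · exfalso
      have : g c = dist (γ s) x := by rw [← hgs]; congr 1; exact congrArg Subtype.val heq.symm
      rcases h.2 with ⟨hs, -⟩ | ⟨hs, -⟩ <;> linarith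
    · exact hlt
  · exact hct
  · have : g c = dist (γ ⟨c, hc01⟩) x := by simp [hg, Set.projIcc_of_mem _ hc01]
    rw [← this, hgc']

/-- Just before a time `m > s` the curve is close to `γ m` (continuity). -/
theorem exists_lt_dist_lt (γ : Curve ℂ) {s m : I} (hsm : s < m) {ε : ℝ} (hε : 0 < ε) :
    ∃ m' : I, s ≤ m' ∧ m' < m ∧ dist (γ m') (γ m) < ε := by
  obtain ⟨δ, hδ, hδε⟩ := Metric.continuousAt_iff.1 (γ.continuous.continuousAt (x := m)) ε hε
  have hsm' : (s : ℝ) < m := hsm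
  set c : ℝ := max (s : ℝ) ((m : ℝ) - δ / 2) with hc
  have hcm : c < m := max_lt hsm' (by linarith)
  have hc01 : c ∈ Set.Icc (0 : ℝ) 1 := ⟨s.2.1.trans (le_max_left _ _), hcm.le.trans m.2.2⟩
  refine ⟨⟨c, hc01⟩, ?_, hcm, hδε ?_⟩
  · show (s : ℝ) ≤ c
    rw [hc]; exact le_max_left _ _
  rw [Subtype.dist_eq, Real.dist_eq, abs_sub_comm, abs_of_pos (by simpa using hcm)]
  have : (m : ℝ) - δ / 2 ≤ c := le_max_right _ _
  show (m : ℝ) - c < δ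
  linarith

/-- Endpoints of a traversal of `D(x; ρ₁, R₁)` are far from every point of the middle sphere. -/
theorem le_dist_of_endpoint {q x y : ℂ} {ρ₁ R₁ : ℝ} (hy : dist y x = (ρ₁ + R₁) / 2)
    (hq : dist q x ≤ ρ₁ ∨ R₁ ≤ dist q x) : (R₁ - ρ₁) / 2 ≤ dist q y := by
  rcases hq with hq | hq
  · have := dist_triangle y q x
    rw [dist_comm y q] at this
    linarith
  · have := dist_triangle q y x
    linarith

/-- Pigeonhole on a circle: among `k ≥ 2` points of the sphere of radius `r > 0` about `x`, two
(with ordered indices) are at distance `< 4πr/k`. -/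
theorem exists_lt_dist_lt_of_mem_sphere {k : ℕ} (hk : 2 ≤ k) {x : ℂ} {r : ℝ} (hr : 0 < r)
    (p : Fin k → ℂ) (hp : ∀ i, dist (p i) x = r) :
    ∃ i j : Fin k, i < j ∧ dist (p i) (p j) < 4 * π * r / k := by
  classical
  have hk1 : (0 : ℝ) < (k : ℝ) - 1 := by
    have : (2 : ℝ) ≤ k := by exact_mod_cast hk
    linarith
  set w : ℝ := 2 * π / ((k : ℝ) - 1) with hw
  have hwpos : 0 < w := div_pos (by positivity) hk1
  set val : Fin k → ℝ := fun i => (arg (p i - x) + π) / w with hval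
  have hval0 : ∀ i, 0 ≤ val i := fun i => by
    have := (arg_mem_Ioc (p i - x)).1
    exact div_nonneg (by linarith) hwpos.le
  have hvalk : ∀ i, val i ≤ (k : ℝ) - 1 := fun i => by
    have h2 := (arg_mem_Ioc (p i - x)).2
    rw [hval, div_le_iff₀ hwpos, hw]
    field_simp
    nlinarith [Real.pi_pos]
  set b : Fin k → ℕ := fun i => min ⌊val i⌋₊ (k - 2) with hb
  -- the boxes: `b i ≤ val i ≤ b i + 1`
  have hbox : ∀ i, (b i : ℝ) ≤ val i ∧ val i ≤ b i + 1 := by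
    intro i
    by_cases hle : ⌊val i⌋₊ ≤ k - 2
    · have hbi : b i = ⌊val i⌋₊ := by simp [hb, hle]
      rw [hbi]
      exact ⟨Nat.floor_le (hval0 i), (Nat.lt_floor_add_one (val i)).le⟩
    · have hbi : b i = k - 2 := by simp [hb, (not_le.1 hle).le]
      rw [hbi]
      refine ⟨?_, ?_⟩
      · have h1 : ((k - 2 : ℕ) : ℝ) ≤ (⌊val i⌋₊ : ℝ) := by exact_mod_cast (not_le.1 hle).le
        exact h1.trans (Nat.floor_le (hval0 i))
      · have h2 : ((k - 2 : ℕ) : ℝ) = (k : ℝ) - 2 := by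
          rw [Nat.cast_sub hk]; norm_num
        rw [h2]; linarith [hvalk i]
  -- pigeonhole: `b` maps `univ` (card k) into `range (k-1)`
  have hmaps : ∀ i ∈ (Finset.univ : Finset (Fin k)), b i ∈ Finset.range (k - 1) := by
    intro i _
    rw [Finset.mem_range]
    have : b i ≤ k - 2 := min_le_right _ _
    omega
  have hcard : (Finset.range (k - 1)).card < (Finset.univ : Finset (Fin k)).card := by
    simp; omega
  obtain ⟨i, -, j, -, hij, hbij⟩ := Finset.exists_ne_map_eq_of_card_lt_of_maps_to hcard hmaps
  -- equal boxes ⇒ angles within `w`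
  have hang : |arg (p i - x) - arg (p j - x)| ≤ w := by
    have h1 := hbox i; have h2 := hbox j
    rw [hbij] at h1
    have hv : |val i - val j| ≤ 1 := by rw [abs_le]; constructor <;> linarith [h1.1, h1.2, h2.1, h2.2]
    have : arg (p i - x) - arg (p j - x) = w * (val i - val j) := by
      simp only [hval]; field_simp; ring
    rw [this, abs_mul, abs_of_pos hwpos]
    calc w * |val i - val j| ≤ w * 1 := by gcongr
      _ = w := mul_one w
  -- chord ≤ arc
  have hpi : ∀ l, p l - x = (r : ℂ) * Complex.exp (arg (p l - x) * Complex.I) := fun l => by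
    have h := norm_mul_exp_arg_mul_I (p l - x)
    have hn : ‖p l - x‖ = r := by rw [← dist_eq_norm]; exact hp l
    rw [hn] at h
    exact h.symm
  have hdist : dist (p i) (p j) ≤ r * w := by
    rw [dist_eq_norm, show p i - p j = (p i - x) - (p j - x) by ring, hpi i, hpi j, ← mul_sub,
      norm_mul, Complex.norm_real, Real.norm_eq_abs, abs_of_pos hr]
    gcongr
    exact (norm_exp_mul_I_sub_exp_mul_I_le _ _).trans hang
  have hdist2 : dist (p i) (p j) ≤ 2 * r := by
    have := dist_triangle (p i) x (p j)
    rw [hp i, dist_comm x (p j), hp j] at this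
    linarith
  -- strictness: `min (r w, 2 r) < 4 π r / k`
  have hlt : dist (p i) (p j) < 4 * π * r / k := by
    have hkpos : (0 : ℝ) < k := by linarith
    rcases eq_or_lt_of_le hk with h2 | h3
    · -- k = 2
      subst h2
      rw [lt_div_iff₀ hkpos]
      push_cast
      nlinarith [Real.pi_gt_three, hdist2, hr]
    · -- k ≥ 3 : r w = 2 π r /(k-1) < 4 π r / k
      have h3' : (3 : ℝ) ≤ k := by exact_mod_cast h3
      refine hdist.trans_lt ?_
      rw [hw, lt_div_iff₀ hkpos]
      rw [show r * (2 * π / ((k : ℝ) - 1)) * k = (2 * π * r * k) / ((k : ℝ) - 1) by ring,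
        div_lt_iff₀ hk1]
      have hpr : 0 < π * r := mul_pos Real.pi_pos hr
      nlinarith [hpr, h3']
  rcases lt_or_gt_of_ne hij with h | h
  · exact ⟨i, j, h, hlt⟩
  · exact ⟨j, i, h, by rwa [dist_comm]⟩

/-- **Pigeonhole on the middle circle** (card pinch-on-a-circle): `k ≥ 2` separate traversals of
`D(x; ρ₁, R₁)` force four separate traversals of `D(y; 4πr/k, (R₁-ρ₁)/2)` for some `y` with
`|y - x| = r = (ρ₁ + R₁)/2`. -/
theorem exists_pinch_of_hasTraversals {γ : Curve ℂ} {x : ℂ} {ρ₁ R₁ : ℝ} {k : ℕ}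
    (hρ : 0 ≤ ρ₁) (hR : ρ₁ < R₁) (hk : 2 ≤ k) (h : γ.HasTraversals k x ρ₁ R₁) :
    ∃ y : ℂ, dist y x = (ρ₁ + R₁) / 2 ∧
      γ.HasTraversals 4 y (4 * Real.pi * ((ρ₁ + R₁) / 2) / k) ((R₁ - ρ₁) / 2) := by
  classical
  obtain ⟨s, t, hst, hsep⟩ := h
  set r : ℝ := (ρ₁ + R₁) / 2 with hr
  set R'' : ℝ := (R₁ - ρ₁) / 2 with hR''
  set η : ℝ := 4 * Real.pi * r / k with hη
  have hρr : ρ₁ < r := by rw [hr]; linarith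
  have hrR : r < R₁ := by rw [hr]; linarith
  have hrpos : 0 < r := by linarith
  -- passage times through the middle sphere
  have hm : ∀ i, ∃ m : I, s i < m ∧ m ≤ t i ∧ dist (γ m) x = r := fun i =>
    exists_mem_sphere_of_isTraversal hρr hrR (hst i)
  choose m hsm hmt hmr using hm
  -- two strands pinch
  obtain ⟨i₀, j₀, hij, hd⟩ :=
    exists_lt_dist_lt_of_mem_sphere hk hrpos (fun i => γ (m i)) hmr
  have hηpos : 0 < η := by
    have hkpos : (0 : ℝ) < k := by have : (2:ℝ) ≤ k := by exact_mod_cast hk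
                                   linarith
    rw [hη]; positivity
  set y : ℂ := γ (m i₀) with hy
  -- times just before the passages
  obtain ⟨m₁, hsm₁, hm₁m, hd₁⟩ := exists_lt_dist_lt γ (hsm i₀) hηpos
  obtain ⟨m₂, hsm₂, hm₂m, hd₂⟩ := exists_lt_dist_lt γ (hsm j₀) (sub_pos.2 hd)
  have hd₂' : dist (γ m₂) y ≤ η := by
    have := dist_triangle (γ m₂) (γ (m j₀)) y
    rw [hy] at this ⊢
    have hcomm : dist (γ (m j₀)) (γ (m i₀)) = dist (γ (m i₀)) (γ (m j₀)) := dist_comm _ _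
    linarith
  -- far endpoints
  have hfar : ∀ i, R'' ≤ dist (γ (s i)) y ∧ R'' ≤ dist (γ (t i)) y := by
    intro i
    have hyx : dist y x = (ρ₁ + R₁) / 2 := hmr i₀
    rcases (hst i).2 with ⟨hs, ht⟩ | ⟨hs, ht⟩
    · exact ⟨le_dist_of_endpoint hyx (Or.inl hs), le_dist_of_endpoint hyx (Or.inr ht)⟩
    · exact ⟨le_dist_of_endpoint hyx (Or.inr hs), le_dist_of_endpoint hyx (Or.inl ht)⟩
  refine ⟨y, hmr i₀, ?_⟩
  -- the four segments
  refine ⟨![s i₀, m i₀, s j₀, m j₀], ![m₁, t i₀, m₂, t j₀], ?_, ?_⟩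
  · intro n
    fin_cases n
    · exact ⟨hsm₁, Or.inr ⟨(hfar i₀).1, hd₁.le⟩⟩
    · refine ⟨hmt i₀, Or.inl ⟨?_, (hfar i₀).2⟩⟩
      simp [hy]; exact hηpos.le
    · exact ⟨hsm₂, Or.inr ⟨(hfar j₀).1, hd₂'⟩⟩
    · refine ⟨hmt j₀, Or.inl ⟨?_, (hfar j₀).2⟩⟩
      have : dist (γ (m j₀)) y ≤ η := by rw [dist_comm, hη]; exact hd.le
      simpa using this
  · -- strict separation of the parameter intervals
    have h01 : m₁ < m i₀ := hm₁m
    have h12 : t i₀ < s j₀ := hsep hij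
    have h23 : m₂ < m j₀ := hm₂m
    have a1 : m i₀ ≤ t i₀ := hmt i₀
    have a2 : s j₀ ≤ m₂ := hsm₂
    intro a c hac
    fin_cases a <;> fin_cases c <;> simp at hac ⊢
    · exact h01
    · exact lt_of_lt_of_le (lt_of_le_of_lt (h01.le.trans a1) h12) le_rfl
    · exact lt_of_lt_of_le (lt_of_le_of_lt ((h01.le.trans a1)) h12) (a2.trans h23.le)
    · exact h12
    · exact lt_of_lt_of_le h12 (a2.trans h23.le)
    · exact h23

end Pinch

noncomputable section

/-- The law-mass of the Aizenman–Burchard event "`D(y; η, R)` is traversed by `k` separate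
segments of the SAW polyline" under the critical SAW law of `(D; a_δ, b_δ)` at mesh `δ`
(the set is verbatim the crux's, with general `k, y, η, R`). -/
def travMass (D : DobrushinDomain) (a b : ℝ → Site 2) (δ : ℝ) (k : ℕ) (y : ℂ) (η R : ℝ) :
    ENNReal :=
  SAW.law D.carrier δ (a δ) (b δ)
    {γ | (⟨γ.walk.toCurve (meshPoint δ)⟩ : Curve ℂ).HasTraversals k y η R}

/-- **Per-shell tightness**: for every FIXED shell `D(x; ρ, R)` the traversal counts are
bounded in probability uniformly in the mesh `δ ≤ min δ₀ ρ` — no uniformity over shells. -/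
def PerShellTight : Prop :=
  ∀ (D : DobrushinDomain) (a b : ℝ → Site 2), SAW.IsEndpointApprox D a b →
    ∃ δ₀ : ℝ, 0 < δ₀ ∧ ∀ (x : ℂ) (ρ R : ℝ), 0 < ρ → ρ < R →
      ∀ ε : ℝ, 0 < ε → ∃ k : ℕ, ∀ δ ∈ Set.Ioc (0 : ℝ) δ₀, δ ≤ ρ →
        travMass D a b δ k x ρ R ≤ ENNReal.ofReal ε

/-- **First lemma (PROVED): per-shell tightness implies the crux.** The threshold `k(x,ρ,R)` is
chosen shell by shell with tail `≤ (ρ/R)^3`; then `K = 1`, `λ = 3 > 2`. -/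
theorem shellCrossingBound_of_perShellTight (h : PerShellTight) : ShellCrossingBound := by
  intro D a b hab
  obtain ⟨δ₀, hδ₀, hT⟩ := h D a b hab
  classical
  -- shell-dependent threshold
  let k : ℂ → ℝ → ℝ → ℕ := fun x ρ R =>
    if hh : 0 < ρ ∧ ρ < R then
      Classical.choose (hT x ρ R hh.1 hh.2 ((ρ / R) ^ (3 : ℝ))
        (Real.rpow_pos_of_pos (div_pos hh.1 (hh.1.trans hh.2)) 3))
    else 0
  refine ⟨k, 1, 3, δ₀, by norm_num, hδ₀, ?_⟩
  intro δ hδ x ρ R hδρ hρR hR1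
  have hρ : 0 < ρ := lt_of_lt_of_le hδ.1 hδρ
  have hh : 0 < ρ ∧ ρ < R := ⟨hρ, hρR⟩
  have hspec := Classical.choose_spec (hT x ρ R hh.1 hh.2 ((ρ / R) ^ (3 : ℝ))
    (Real.rpow_pos_of_pos (div_pos hh.1 (hh.1.trans hh.2)) 3)) δ hδ hδρ
  have hk : k x ρ R = Classical.choose (hT x ρ R hh.1 hh.2 ((ρ / R) ^ (3 : ℝ))
      (Real.rpow_pos_of_pos (div_pos hh.1 (hh.1.trans hh.2)) 3)) := by
    simp only [k, dif_pos hh]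
  show SAW.law D.carrier δ (a δ) (b δ)
      {γ | (⟨γ.walk.toCurve (meshPoint δ)⟩ : Curve ℂ).HasTraversals (k x ρ R) x ρ R} ≤
    ENNReal.ofReal (1 * (ρ / R) ^ (3 : ℝ))
  rw [one_mul, hk]
  exact hspec


/-- **The open atom (UTSP)**: the crux's inequality with `k = 4` and ANY exponent `1 + s > 1`,
for centres at distance `≥ d` from the marked points `D.pt 0, D.pt 1` and outer radii
`≤ R₀(D, d)`; all inner radii `η > 0` (for `η < δ/2` the event is EMPTY: two vertex-disjoint
edges of `δℤ²` are at distance `≥ δ`, so no mesh clause is needed); the mesh threshold `δ₀`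
depends on `(D, a, b)` only (it only serves `IsEndpointApprox` eventuality), the constants
`C, s, R₀` on the distance `d` to the marked points. Predicted exponents
(Coulomb gas, Duplantier–Saleur): bulk `x₄ = 35/12`, flat boundary `7`, needle-like boundary
point `35/12`; all `> 1` (even the free-strand value `2 x₂ = 4/3` is). -/
def UniformTwoStrandPinch : Prop :=
  ∀ (D : DobrushinDomain) (a b : ℝ → Site 2), SAW.IsEndpointApprox D a b →
    ∃ δ₀ : ℝ, 0 < δ₀ ∧ ∀ d : ℝ, 0 < d → ∃ (C s R₀ : ℝ), 0 < s ∧ 0 < R₀ ∧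
      ∀ δ ∈ Set.Ioc (0 : ℝ) δ₀, ∀ (y : ℂ) (η R : ℝ),
        d ≤ dist y (D.pt 0) → d ≤ dist y (D.pt 1) → 0 < η → η < R → R ≤ R₀ →
          travMass D a b δ 4 y η R ≤ ENNReal.ofReal (C * (η / R) ^ (1 + s))

/-- **Card 1, second rung (provable now, 1-D union bound)**: UTSP implies per-shell tightness.
For a shell `D(x; ρ, R)`: pass to a thin sub-shell `D(x; ρ₁, R₁)` (one of five equally spaced
candidate middle radii keeps the middle sphere at distance `≥ (R - ρ)/16` from both marked points;
`HasTraversals.mono'`), cover the middle sphere by `k + 1` equally spaced points, apply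
`exists_pinch_of_hasTraversals` + `HasTraversals.mono` (radius `4πr/k + πr/(k+1) ≤ 5πr/k`, outer
radius `R'' - πr/(k+1) ≥ R''/2`), and sum with `measure_biUnion_finset_le`:
`P(≥ k traversals) ≤ (k+1) · C (10π r / (k R''))^{1+s} → 0` since `1 + s > 1`. -/
theorem perShellTight_of_uniformTwoStrandPinch (h : UniformTwoStrandPinch) : PerShellTight := by
  sorry

/-- The line of card 1, composed: UTSP closes the crux. -/
theorem shellCrossingBound_of_uniformTwoStrandPinch (h : UniformTwoStrandPinch) :
    ShellCrossingBound :=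
  shellCrossingBound_of_perShellTight (perShellTight_of_uniformTwoStrandPinch h)

/-! ### Card 2: socket comparison (restriction covariance as a domain-comparison tool) -/

/-- **Confinement positivity** (rate-free, per pair of domains): for Dobrushin domains
`D' ⊆ D` that COINCIDE near the two marked points (same boundary inside `B(a, d) ∪ B(b, d)`,
same marks), the critical SAW of the big domain stays inside the small one with probability
`≥ c > 0`, uniformly in the mesh. By exact restriction covariance of the `x_c`-law,
`P_{D'}(E) = P_D(E ∩ {γ ⊆ D'}) / P_D(γ ⊆ D')`, so every unconditional upper bound transfers
from `D` to `D'` at the cost `1/c`. -/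
def ConfinementPositivity : Prop :=
  ∀ (D D' : DobrushinDomain) (a b : ℝ → Site 2) (d : ℝ), 0 < d →
    D'.carrier ⊆ D.carrier → D'.pt 0 = D.pt 0 → D'.pt 1 = D.pt 1 →
    D'.carrier ∩ (ball (D.pt 0) d ∪ ball (D.pt 1) d) =
      D.carrier ∩ (ball (D.pt 0) d ∪ ball (D.pt 1) d) →
    SAW.IsEndpointApprox D' a b →
    ∃ c δ₀ : ℝ, 0 < c ∧ 0 < δ₀ ∧ ∀ δ ∈ Set.Ioc (0 : ℝ) δ₀,
      ENNReal.ofReal c ≤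
        SAW.law D.carrier δ (a δ) (b δ) {γ | ∀ v ∈ γ.walk.support, v ∈ meshDomain D'.carrier δ}

/-- **Card 2, transfer rung** (provable now modulo the restriction identity for `SAW.law`):
the two-strand pinch bound for a sub-domain `D'` follows from the bound for any enclosing
domain `D` with the same sockets, divided by the confinement constant. Stated for one
inequality instance. -/
theorem utsp_transfer (D D' : DobrushinDomain) (a b : ℝ → Site 2) (δ c C : ℝ) (y : ℂ)
    (η R s : ℝ) (hsub : D'.carrier ⊆ D.carrier) (hc : 0 < c)
    (hconf : ENNReal.ofReal c ≤
      SAW.law D.carrier δ (a δ) (b δ) {γ | ∀ v ∈ γ.walk.support, v ∈ meshDomain D'.carrier δ})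
    (hbig : travMass D a b δ 4 y η R ≤ ENNReal.ofReal (C * (η / R) ^ (1 + s))) :
    travMass D' a b δ 4 y η R ≤ ENNReal.ofReal (C / c * (η / R) ^ (1 + s)) := by
  sorry

end

end Summit.CriticalPhenomena.SAWScalingLimit.Cruxes.ShellCrossingBound.Ideator2
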